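import Literature.NumberTheory.EllipticCurves.KugaSatoFibrePowerEquivariance
import Literature.NumberTheory.EllipticCurves.KugaSatoLevelTwist
import Literature.NumberTheory.EllipticCurves.KugaSatoSchollProjector
import HarnessLib

/-!
# `SL₂(ℤ/N)` normalises Scholl's group `Γ` and commutes with the projector `Π_ε`

Topic: `Literature/NumberTheory/EllipticCurves`. For a `KugaSatoVariety K m N` (`KugaSatoVariety.lean`)
the automorphism `slW g` of `W` (`g ∈ SL₂(ℤ/N)`) extends the fibre power `F = G ×_{slY g} ⋯ ×_{slY g} G`
of a base change `G : E → E` of the universal curve over the component which carries the twisted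
level structure `φ ∘ g` to `φ` (field `sl_extends`). Since `G` is a homomorphism of group schemes
intertwining `(φ ∘ g)(a, b)` with `φ(a, b)` (`KugaSatoFibrePowerEquivariance.lean`), and `F`
commutes with the inversions and the permutations of the factors (`mapFibrePower_neg`,
`mapFibrePower_perm`), uniqueness of extensions from the dense open `E^m ↪ W`
(`KugaSatoVariety.hom_ext'`) gives, on `W`:

* `negW_slW`, `permW_slW` — `slW g` **commutes** with the inversions `negW i` and the
  permutations `permW σ`;
* `translW_slW` — `slW g` **intertwines the translations**:
  `translW i (g · (a, b)) ≫ slW g = slW g ≫ translW i (a, b)` (Deligne (3.7), Deninger–Scholl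
  (4.10): `GL₂(ℤ/n)` acts on the level-`n` tower compatibly with the group structure; here for
  the stabiliser `SL₂(ℤ/N)` of the component);

so `slW(SL₂(ℤ/N))` normalises Scholl's group `Γ` (Deninger–Scholl 5.3 (i)), permuting the
translations of each factor through the bijection `g` of `(ℤ/N)²` and fixing the other
generators. Consequently, in `ℚ[Aut W]`:

* `commute_translProjector_of_slA`, `commute_negProjector_of_slA`,
  `commute_permProjector_of_slA`, and **`commute_schollProjector_of_slA`** — `[slW g]` commutes
  with `Π_T`, `Π_M`, `Π_S` and with Scholl's projector `Π_ε` (`KugaSatoSchollProjector.lean`); also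
  with `[slW g]` replaced by `[(slW g)⁻¹]` (`commute_schollProjector_of_slA_inv`). Hence
  `SL₂(ℤ/N)` acts on the `ε`-part of any `ℚ[Aut W]`-module; for level-one forms the relevant
  piece of `H^{m+1}(W)` is the `SL₂(ℤ/N)`-invariants of the `ε`-part (design notes of
  `KugaSatoVariety.lean`; Betti version in `KugaSatoSchollProjectorBettiSL.lean`).

Hypotheses: `hc : Commute φ.P φ.Q` / `[IsCommMonObj V.curve.E]` as in the companion files. No
named facts.

## References

* P. Deligne, *Formes modulaires et représentations ℓ-adiques*, Sém. Bourbaki 355 (1969), (3.7).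
  [Deligne1971Bourbaki355]
* C. Deninger, A. J. Scholl, *The Beilinson conjectures*, in *L-functions and Arithmetic*,
  LMS LNS 153 (1991), (4.10), 5.3 (i). [DeningerScholl1991]
-/

universe u

open CategoryTheory Limits AlgebraicGeometry MonoidalCategory CartesianMonoidalCategory
open scoped MonObj MatrixGroups

noncomputable section

namespace Literature.NumberTheory.EllipticCurves

/-- In a monoid algebra, if `[g]` commutes with `a` then so does `[g⁻¹]`. [folklore] -/
theorem commute_of_inv_of_commute_of {H : Type*} [Group H] {a : MonoidAlgebra ℚ H} {g : H}
    (h : Commute (MonoidAlgebra.of ℚ H g) a) : Commute (MonoidAlgebra.of ℚ H g⁻¹) a := by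
  have h1 : MonoidAlgebra.of ℚ H g⁻¹ * MonoidAlgebra.of ℚ H g = 1 := by
    rw [← map_mul, inv_mul_cancel, map_one]
  have h2 : MonoidAlgebra.of ℚ H g * MonoidAlgebra.of ℚ H g⁻¹ = 1 := by
    rw [← map_mul, mul_inv_cancel, map_one]
  change MonoidAlgebra.of ℚ H g⁻¹ * a = a * MonoidAlgebra.of ℚ H g⁻¹
  calc MonoidAlgebra.of ℚ H g⁻¹ * a
      = MonoidAlgebra.of ℚ H g⁻¹ * a * (MonoidAlgebra.of ℚ H g * MonoidAlgebra.of ℚ H g⁻¹) := by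
        rw [h2, mul_one]
    _ = MonoidAlgebra.of ℚ H g⁻¹ * (a * MonoidAlgebra.of ℚ H g) * MonoidAlgebra.of ℚ H g⁻¹ := by
        simp only [mul_assoc]
    _ = MonoidAlgebra.of ℚ H g⁻¹ * (MonoidAlgebra.of ℚ H g * a) * MonoidAlgebra.of ℚ H g⁻¹ := by
        rw [h.eq]
    _ = a * MonoidAlgebra.of ℚ H g⁻¹ := by rw [← mul_assoc, h1, one_mul]

namespace KugaSatoVariety

open EllCurveOver EllCurveOver.LevelStructure

variable {K : Type u} [Field K] {m N : ℕ} (V : KugaSatoVariety K m N)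

/-! ### The relations on `W` -/

/-- The data of `sl_extends` with `F` identified: along `slY g` there is a base change
`G : E → E` carrying `(φ ∘ g)` to `φ` such that `slW g` extends the fibre power `G^m`
(`KugaSato.mapFibrePower`), by uniqueness of morphisms into `E^m` (`mapFibrePower_unique`).
[folklore] -/
theorem exists_slW_extends_mapFibrePower (g : SL(2, ZMod N)) :
    ∃ (G : V.curve.E.left ⟶ V.curve.E.left) (hG : V.curve.IsBaseChangeVia V.curve (V.slY g).left G),
      (V.level.section_ (g.1 0 0, g.1 1 0)).left ≫ G = (V.slY g).left ≫ V.level.P.left ∧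
      (V.level.section_ (g.1 0 1, g.1 1 1)).left ≫ G = (V.slY g).left ≫ V.level.Q.left ∧
      V.jW ≫ (V.slW g).hom.left = KugaSato.mapFibrePower (V.slY g).left G hG.w m ≫ V.jW := by
  obtain ⟨G, F, hG, hP, hQ, hF, hFhom, hext⟩ := V.sl_extends g
  refine ⟨G, hG, hP, hQ, ?_⟩
  rw [hext, KugaSato.mapFibrePower_unique (V.slY g).left G hG.w m F hFhom hF]

/-- **`slW g` commutes with the inversions**: `negW i ≫ slW g = slW g ≫ negW i` — both extend
`neg i ≫ G^m = G^m ≫ neg i` (`KugaSato.mapFibrePower_neg`: `G` is a homomorphism).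
[cite: DeningerScholl1991, 5.3 (i)] -/
theorem negW_slW (g : SL(2, ZMod N)) (i : Fin m) :
    V.negW i ≪≫ V.slW g = V.slW g ≪≫ V.negW i := by
  obtain ⟨G, hG, -, -, hext⟩ := V.exists_slW_extends_mapFibrePower g
  refine Iso.ext (V.hom_ext' ?_)
  rw [Iso.trans_hom, Iso.trans_hom, Over.comp_left, Over.comp_left, reassoc_of% (V.negW_extends i),
    hext, reassoc_of% hext, V.negW_extends i, ← Category.assoc, ← Category.assoc,
    KugaSato.mapFibrePower_neg hG m i]

/-- **`slW g` commutes with the permutations of the factors**: `permW σ ≫ slW g = slW g ≫ permW σ`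
(`KugaSato.mapFibrePower_perm`). [cite: DeningerScholl1991, 5.3 (i)] -/
theorem permW_slW (g : SL(2, ZMod N)) (σ : Equiv.Perm (Fin m)) :
    V.permW σ ≪≫ V.slW g = V.slW g ≪≫ V.permW σ := by
  obtain ⟨G, hG, -, -, hext⟩ := V.exists_slW_extends_mapFibrePower g
  refine Iso.ext (V.hom_ext' ?_)
  rw [Iso.trans_hom, Iso.trans_hom, Over.comp_left, Over.comp_left, reassoc_of% (V.permW_extends σ),
    hext, reassoc_of% hext, V.permW_extends σ, ← Category.assoc, ← Category.assoc,
    KugaSato.mapFibrePower_perm (V.slY g).left G hG.w m σ]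

/-- **`slW g` intertwines the translations**: `translW i (g · (a, b)) ≫ slW g = slW g ≫ translW i (a, b)`,
where `g · (a, b) = (g₀₀ a + g₀₁ b, g₁₀ a + g₁₁ b)` (`LevelStructure.vecAct`): `G` carries the section
`(φ ∘ g)(a, b) = φ(g · (a, b))` to `φ(a, b)` (`KugaSato.mapFibrePower_transl_section_`,
`LevelStructure.twist_section_`). Requires the basis sections to commute.
[cite: DeningerScholl1991, (4.10) and 5.3 (i)] -/
theorem translW_slW [NeZero N] (hc : Commute V.level.P V.level.Q) (g : SL(2, ZMod N)) (i : Fin m)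
    (ab : ZMod N × ZMod N) :
    V.translW i (vecAct g.1 ab) ≪≫ V.slW g = V.slW g ≪≫ V.translW i ab := by
  obtain ⟨G, hG, hP, hQ, hext⟩ := V.exists_slW_extends_mapFibrePower g
  have hφ : (V.level.twist hc g).IsBaseChangeVia V.level (V.slY g).left G := ⟨hG, hP, hQ⟩
  have key : KugaSato.mapFibrePower (V.slY g).left G hG.w m ≫
      (KugaSato.transl V.curve.E m i (V.level.section_ ab)).left =
        (KugaSato.transl V.curve.E m i (V.level.section_ (vecAct g.1 ab))).left ≫
          KugaSato.mapFibrePower (V.slY g).left G hG.w m := by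
    have h := KugaSato.mapFibrePower_transl_section_ hφ m i ab
    rwa [twist_section_] at h
  refine Iso.ext (V.hom_ext' ?_)
  rw [Iso.trans_hom, Iso.trans_hom, Over.comp_left, Over.comp_left,
    reassoc_of% (V.translW_extends i (vecAct g.1 ab)), hext, reassoc_of% hext, V.translW_extends i ab,
    ← Category.assoc, ← Category.assoc, ← key]

/-! ### In the group `Aut W` -/

/-- `slW g` as an element of the group `Aut W`. [folklore] -/
abbrev slA (g : SL(2, ZMod N)) : Aut V.W := V.slW g

/-- `slW g` commutes with `negW i` in `Aut W`. [folklore] -/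
theorem commute_slA_negA (g : SL(2, ZMod N)) (i : Fin m) : Commute (V.slA g) (V.negA i) :=
  V.negW_slW g i

/-- `slW g` commutes with `permW σ` in `Aut W`. [folklore] -/
theorem commute_slA_permA (g : SL(2, ZMod N)) (σ : Equiv.Perm (Fin m)) :
    Commute (V.slA g) (V.permA σ) :=
  V.permW_slW g σ

/-- `slW g * translW i (g · u) = translW i u * slW g` in `Aut W`. [folklore] -/
theorem slA_mul_translA [NeZero N] (hc : Commute V.level.P V.level.Q) (g : SL(2, ZMod N))
    (i : Fin m) (u : ZMod N × ZMod N) :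
    V.slA g * V.translA i (vecAct g.1 u) = V.translA i u * V.slA g :=
  V.translW_slW hc g i u

/-- Equivalently, `slW g * translW i u = translW i (g⁻¹ · u) * slW g`. [folklore] -/
theorem slA_mul_translA' [NeZero N] (hc : Commute V.level.P V.level.Q) (g : SL(2, ZMod N))
    (i : Fin m) (u : ZMod N × ZMod N) :
    V.slA g * V.translA i u = V.translA i (vecAct (g⁻¹).1 u) * V.slA g := by
  conv_lhs => rw [← (vecActEquiv g).apply_symm_apply u]
  exact V.slA_mul_translA hc g i _

/-- The bijection of `((ℤ/N)²)^m` induced on the translation parameters by conjugation with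
`slW g`: `t ↦ (g⁻¹ · tᵢ)ᵢ`. [folklore] -/
def slTranslEquiv (m : ℕ) {N : ℕ} (g : SL(2, ZMod N)) :
    (Fin m → Multiplicative (ZMod N × ZMod N)) ≃ (Fin m → Multiplicative (ZMod N × ZMod N)) :=
  Equiv.piCongrRight fun _ =>
    Multiplicative.toAdd.trans ((vecActEquiv g⁻¹).trans Multiplicative.ofAdd)

/-- Unfolding of `slTranslEquiv`. [folklore] -/
theorem slTranslEquiv_apply (g : SL(2, ZMod N)) (t : Fin m → Multiplicative (ZMod N × ZMod N))
    (i : Fin m) : slTranslEquiv m g t i = Multiplicative.ofAdd (vecAct (g⁻¹).1 (t i).toAdd) := rfl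

/-- **`slW g` normalises the translations**: `slW g * (∏ᵢ translW i (t i)) =
(∏ᵢ translW i (g⁻¹ · t i)) * slW g`. [cite: DeningerScholl1991, 5.3 (i)] -/
theorem slA_mul_translPiHom [NeZero N] [IsCommMonObj V.curve.E] (g : SL(2, ZMod N))
    (t : Fin m → Multiplicative (ZMod N × ZMod N)) :
    V.slA g * V.translPiHom t = V.translPiHom (slTranslEquiv m g t) * V.slA g := by
  classical
  have key : MulAut.conj (V.slA g) (V.translPiHom t) = V.translPiHom (slTranslEquiv m g t) := by
    rw [translPiHom, MonoidHom.noncommPiCoprod_apply, MonoidHom.noncommPiCoprod_apply,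
      Finset.map_noncommProd _ _ _ (MulAut.conj (V.slA g))]
    refine Finset.noncommProd_congr rfl (fun j _ => ?_) _
    rw [MulAut.conj_apply, translHom_apply, translHom_apply, slTranslEquiv_apply, toAdd_ofAdd,
      V.slA_mul_translA' (Commute.all _ _) g j, mul_inv_cancel_right]
  rw [MulAut.conj_apply] at key
  exact mul_inv_eq_iff_eq_mul.mp key

/-- `slW g` commutes with `∏ᵢ (negW i)^{s i}`. [folklore] -/
theorem commute_slA_negPiHom (g : SL(2, ZMod N)) (s : Fin m → Multiplicative (ZMod 2)) :
    Commute (V.slA g) (V.negPiHom s) := by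
  classical
  rw [negPiHom, MonoidHom.noncommPiCoprod_apply]
  refine Finset.noncommProd_commute _ _ _ _ fun j _ => ?_
  rw [negHom_apply]
  exact (V.commute_slA_negA g j).pow_right _

/-! ### In `ℚ[Aut W]`: `[slW g]` commutes with Scholl's projector -/

/-- `[slW g]` commutes with `Π_T` (it permutes the translations). [folklore] -/
theorem commute_translProjector_of_slA [NeZero N] [IsCommMonObj V.curve.E] (g : SL(2, ZMod N)) :
    Commute V.translProjector (MonoidAlgebra.of ℚ _ (V.slA g)) :=
  commute_characterProjector_of _ _ _ (slTranslEquiv m g) (V.slA_mul_translPiHom g) fun _ => rfl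

/-- `[slW g]` commutes with `Π_M`. [folklore] -/
theorem commute_negProjector_of_slA (g : SL(2, ZMod N)) :
    Commute V.negProjector (MonoidAlgebra.of ℚ _ (V.slA g)) :=
  commute_characterProjector_of _ _ _ (Equiv.refl _)
    (fun s => by rw [Equiv.refl_apply]; exact (V.commute_slA_negPiHom g s).eq) fun _ => rfl

/-- `[slW g]` commutes with `Π_S`. [folklore] -/
theorem commute_permProjector_of_slA (g : SL(2, ZMod N)) :
    Commute V.permProjector (MonoidAlgebra.of ℚ _ (V.slA g)) :=
  commute_characterProjector_of _ _ _ (Equiv.refl _)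
    (fun σ => by rw [Equiv.refl_apply, permHom_apply]; exact (V.commute_slA_permA g σ).eq)
    fun _ => rfl

/-- **`[slW g]` commutes with Scholl's projector `Π_ε`**: `SL₂(ℤ/N)` normalises `Γ` preserving
`ε`, so it acts on the `ε`-part of every `ℚ[Aut W]`-module (Deninger–Scholl (4.10), 5.3 (i)).
[cite: DeningerScholl1991, 5.3 (i)] -/
theorem commute_schollProjector_of_slA [NeZero N] [IsCommMonObj V.curve.E] (g : SL(2, ZMod N)) :
    Commute V.schollProjector (MonoidAlgebra.of ℚ _ (V.slA g)) :=
  ((V.commute_translProjector_of_slA g).mul_left (V.commute_negProjector_of_slA g)).mul_left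
    (V.commute_permProjector_of_slA g)

/-- `[(slW g)⁻¹]` commutes with `Π_ε` as well. [folklore] -/
theorem commute_schollProjector_of_slA_inv [NeZero N] [IsCommMonObj V.curve.E]
    (g : SL(2, ZMod N)) :
    Commute V.schollProjector (MonoidAlgebra.of ℚ _ (V.slA g)⁻¹) :=
  (commute_of_inv_of_commute_of (V.commute_schollProjector_of_slA g).symm).symm

end KugaSatoVariety

end Literature.NumberTheory.EllipticCurves

end
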